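import Literature.NumberTheory.Transcendental.OnePeriodsClosedPathsGenusZero
import Mathlib.FieldTheory.AlgebraicClosure
import Mathlib.Analysis.Complex.Polynomial.Basic
import HarnessLib

/-!
# Complete periods of plane curves: the residue theorem along loops and graphs of rational functions

Companion of `Literature/NumberTheory/Transcendental/OnePeriodsClosedPaths.lean` (the named fact
`Literature.NumberTheory.Transcendental.completePlaneCurvePeriods_zero_or_transcendental`:
complete periods `S = Σᵢ nᵢ ∮_{γᵢ} (A dx + B dy)` of polynomial `1`-forms over `ℚ` along closed
`C¹` loops in the smooth locus of a plane curve `p = 0` over `ℚ` are `0` or transcendental;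
Huber–Wüstholz, *Transcendence and Linear Relations of 1-Periods*, Cambridge Tracts 227 (2022),
Cor. 13.13, p. 126 of the held text) and of `OnePeriodsClosedPathsGenusZero.lean`.

Two results.

* **The residue theorem for rational `1`-forms along a closed `C¹` loop**
  (`ClosedPathPeriods.exists_residues_prod`): for a field `K ⊆ ℂ`, `P ∈ K[X]` and
  `Q = ∏_{ρ ∈ s} (X − ρ)^{m_ρ}` (`s ⊂ K` finite) there are residues `c_ρ ∈ K` with
  `∮ P(x)/Q(x) dx = 2πi Σ_ρ c_ρ wind(x − ρ)` for every `C¹` loop `x` avoiding `s` — partial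
  fractions by induction on `s` (Bezout for coprime factors, Taylor expansion at a pole) and
  `∮ (x − ρ)ⁿ dx = 2πi · wind · [n = −1]`.  This is the engine for all genus-`0` computations of
  complete periods (values in `K · 2πi`); for `K` algebraically closed (e.g. `ℚ̄`) and an
  arbitrary `Q ≠ 0` see `ClosedPathPeriods.exists_residues` (factorisation over the roots).
* **The rational-graph slice of the named fact**
  (`completePlaneCurvePeriods_zero_or_transcendental_of_ratGraph`): the fact holds outright for
  every curve `y q(x) = r(x)` with `q, r ∈ ℚ[x]` coprime — the graph of `r/q` over
  `𝔸¹ ∖ {q = 0}`, a curve `ℙ¹ ∖ {points}` of genus `0`.  Along a loop `x` avoids the algebraic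
  roots of `q` (no common zero of `q, r`), `A dx + B dy` pulls back to a rational form over `ℚ`,
  so `S = 2πi · Σ_ρ c_ρ W_ρ` with `c_ρ ∈ ℚ̄`, `W_ρ ∈ ℤ`, and Lindemann's theorem concludes
  (`ClosedPathPeriods.eq_zero_of_isAlgebraic_mul_two_pi_I`).  Huber–Wüstholz, Remark 13.10: in
  genus `0` the theorem is the transcendence of `π`.  The symmetric family `x q(y) = r(y)`
  follows by swapping the coordinates (`completePlaneCurvePeriods_of_swap`,
  `completePlaneCurvePeriods_zero_or_transcendental_of_ratGraph'`).

Coefficients in `ℚ̄` are handled inside the intermediate field `algebraicClosure ℚ ℂ` (an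
algebraic closure of `ℚ`, so `q` splits there).

## References

* A. Huber, G. Wüstholz, *Transcendence and Linear Relations of 1-Periods*, Cambridge Tracts in
  Mathematics 227, CUP 2022, doi:10.1017/9781009019729 [HuberWustholz2022]: Cor. 13.13 (p. 126),
  Thm. 13.9 and Remark 13.10 (p. 125), Lemma 12.4 (p. 114).
* F. Lindemann, *Über die Zahl π*, Math. Ann. 20 (1882) [Lindemann1882].
-/

noncomputable section

open MvPolynomial Complex
open scoped Real Polynomial

namespace Literature.NumberTheory.Transcendental

namespace ClosedPathPeriods

open Literature.Topology.PlaneTopology Literature.Analysis.Complex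

/-! ### The residue theorem for rational `1`-forms along a closed loop -/

section Rational

open Polynomial

variable {K : Type*} [Field K] [Algebra K ℂ]

/-- **`∮ (x − ρ)ⁿ dx`** along a `C¹` loop `x` with `x 0 = x 1` avoiding `ρ`: `2πi · wind(x − ρ)`
for `n = −1`, else `0`. [folklore] -/
theorem integral_zpow_sub_mul_deriv {x : ℝ → ℂ} (hx : ContDiff ℝ 1 x) (h01 : x 0 = x 1) (ρ : ℂ)
    (h0 : ∀ t, x t ≠ ρ) (n : ℤ) :
    (∫ t in (0:ℝ)..1, (x t - ρ) ^ n * deriv x t) =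
      if n = -1 then (wind (fun t => x t - ρ) : ℂ) * (2 * π * I) else 0 := by
  have hy : ContDiff ℝ 1 (fun t => x t - ρ) := hx.sub contDiff_const
  have hy0 : ∀ t, x t - ρ ≠ 0 := fun t => sub_ne_zero.2 (h0 t)
  have hy01 : x 0 - ρ = x 1 - ρ := by rw [h01]
  have hd : ∀ t, deriv x t = deriv (fun s => x s - ρ) t := fun t => (deriv_sub_const ρ).symm
  simp_rw [hd]
  split_ifs with hn
  · subst hn
    exact integral_zpow_neg_one_mul_deriv hy hy0 hy01
  · exact integral_zpow_mul_deriv_eq_zero hy hy0 hy01 hn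

/-- **Taylor expansion at a pole**: `v(z)/(z − ρ)^m = Σᵢ aᵢ (z − ρ)^{i − m}` with
`aᵢ = (taylor ρ v)ᵢ ∈ K`, for `z ≠ ρ`. [folklore] -/
theorem eval₂_div_pow_eq_sum (v : K[X]) (ρ : K) (m : ℕ) {z : ℂ} (hz : z ≠ algebraMap K ℂ ρ) :
    v.eval₂ (algebraMap K ℂ) z / (z - algebraMap K ℂ ρ) ^ m =
      ∑ i ∈ (taylor ρ v).support, algebraMap K ℂ ((taylor ρ v).coeff i) *
        (z - algebraMap K ℂ ρ) ^ ((i : ℤ) - m) := by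
  have hz' : z - algebraMap K ℂ ρ ≠ 0 := sub_ne_zero.2 hz
  conv_lhs => rw [← sum_taylor_eq v ρ]
  rw [Polynomial.sum_def, Polynomial.eval₂_finsetSum, Finset.sum_div]
  refine Finset.sum_congr rfl fun i _ => ?_
  rw [Polynomial.eval₂_mul, Polynomial.eval₂_C, Polynomial.eval₂_pow, Polynomial.eval₂_sub,
    Polynomial.eval₂_X, Polynomial.eval₂_C, zpow_sub₀ hz', zpow_natCast, zpow_natCast, mul_div_assoc]

/-- `t ↦ ∏_{σ ∈ s} (x t − σ)^{m σ}` is continuous and, if `x` avoids `s`, nowhere zero. [folklore] -/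
theorem continuous_prod_pow_sub {x : ℝ → ℂ} (hx : Continuous x) (s : Finset K) (m : K → ℕ) :
    Continuous fun t => ∏ σ ∈ s, (x t - algebraMap K ℂ σ) ^ m σ :=
  continuous_finsetProd s fun _ _ => (hx.sub continuous_const).pow _

omit [Algebra K ℂ] in
/-- Distinct linear factors are coprime, with multiplicities. [folklore] -/
theorem isCoprime_pow_X_sub_C_prod {ρ : K} {s : Finset K} (hρ : ρ ∉ s) (m : K → ℕ) :
    IsCoprime ((Polynomial.X - Polynomial.C ρ) ^ m ρ)
      (∏ σ ∈ s, (Polynomial.X - Polynomial.C σ) ^ m σ) := by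
  refine IsCoprime.prod_right fun σ hσ => ?_
  have hne : ρ - σ ≠ 0 := sub_ne_zero.2 fun h => hρ (h ▸ hσ)
  exact ((isCoprime_X_sub_C_of_isUnit_sub hne.isUnit).pow_left).pow_right

/-- **The residue theorem for rational `1`-forms along a closed `C¹` loop.**  Let `K ⊆ ℂ` be a
field, `P ∈ K[X]`, and `Q = ∏_{ρ ∈ s} (X − ρ)^{m_ρ}` with `s ⊂ K` finite.  There are RESIDUES
`c_ρ ∈ K` (`ρ ∈ s`) such that for every `C¹` loop `x : ℝ → ℂ` with `x 0 = x 1` avoiding `s`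

  `∮ P(x)/Q(x) dx = 2πi · Σ_{ρ ∈ s} c_ρ · wind(x − ρ)`.

Proof by induction on `s` (partial fractions): Bezout for the coprime factors
`(X − ρ)^{m_ρ}` and `∏_{σ ≠ ρ}` splits `P/Q = u/Q′ + v/(X − ρ)^{m_ρ}`, the Taylor expansion of
`v` at `ρ` and `∮ (x − ρ)ⁿ dx = 2πi·wind·[n = −1]` give the new residue.  In particular the
integral lies in `K · 2πi` — for `K ⊆ ℚ̄` it is `0` or transcendental (Lindemann). [folklore] -/
theorem exists_residues_prod (s : Finset K) (m : K → ℕ) (P : K[X]) :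
    ∃ c : K → K, ∀ x : ℝ → ℂ, ContDiff ℝ 1 x → x 0 = x 1 →
      (∀ t, ∀ ρ ∈ s, x t ≠ algebraMap K ℂ ρ) →
      (∫ t in (0:ℝ)..1, P.eval₂ (algebraMap K ℂ) (x t) /
          (∏ ρ ∈ s, (x t - algebraMap K ℂ ρ) ^ m ρ) * deriv x t) =
        (∑ ρ ∈ s, algebraMap K ℂ (c ρ) * wind (fun t => x t - algebraMap K ℂ ρ)) *
          (2 * π * I) := by
  classical
  induction s using Finset.induction_on generalizing P with
  | empty =>
    refine ⟨fun _ => 0, fun x hx h01 _ => ?_⟩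
    simp only [Finset.prod_empty, div_one, Finset.sum_empty, zero_mul]
    have h := integral_eval_mul_deriv_eq_zero hx h01 (P.map (algebraMap K ℂ))
    simpa only [Polynomial.eval_map] using h
  | insert ρ s hρ ih =>
    -- Bezout for the coprime factors `(X - ρ)^{m ρ}` and `∏_{σ ∈ s} (X - σ)^{m σ}`
    obtain ⟨a, b, hab⟩ := isCoprime_pow_X_sub_C_prod hρ m
    obtain ⟨c', hc'⟩ := ih (P * a)
    refine ⟨Function.update c' ρ (∑ i ∈ (taylor ρ (P * b)).support,
      if (i : ℤ) - m ρ = -1 then (taylor ρ (P * b)).coeff i else 0), fun x hx h01 havoid => ?_⟩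
    have hρ' : ∀ t, x t ≠ algebraMap K ℂ ρ := fun t => havoid t ρ (Finset.mem_insert_self ρ s)
    have hs' : ∀ t, ∀ σ ∈ s, x t ≠ algebraMap K ℂ σ := fun t σ hσ =>
      havoid t σ (Finset.mem_insert_of_mem hσ)
    have hH0 : ∀ t, (∏ σ ∈ s, (x t - algebraMap K ℂ σ) ^ m σ) ≠ 0 := fun t =>
      Finset.prod_ne_zero_iff.2 fun σ hσ => pow_ne_zero _ (sub_ne_zero.2 (hs' t σ hσ))
    have hG0 : ∀ t, (x t - algebraMap K ℂ ρ) ^ m ρ ≠ 0 := fun t =>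
      pow_ne_zero _ (sub_ne_zero.2 (hρ' t))
    have hxd : Continuous (deriv x) := hx.continuous_deriv le_rfl
    -- pointwise partial fractions: `P/(G H) = (P a)/H + (P b)/G`, `(P b)/G` Taylor-expanded
    have hpf0 : ∀ t, P.eval₂ (algebraMap K ℂ) (x t) /
        (∏ σ ∈ insert ρ s, (x t - algebraMap K ℂ σ) ^ m σ) =
        (P * a).eval₂ (algebraMap K ℂ) (x t) / (∏ σ ∈ s, (x t - algebraMap K ℂ σ) ^ m σ) +
        ∑ i ∈ (taylor ρ (P * b)).support, algebraMap K ℂ ((taylor ρ (P * b)).coeff i) *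
          (x t - algebraMap K ℂ ρ) ^ ((i : ℤ) - m ρ) := by
      intro t
      have hev := congrArg (Polynomial.eval₂ (algebraMap K ℂ) (x t)) hab
      simp only [Polynomial.eval₂_add, Polynomial.eval₂_mul, Polynomial.eval₂_one,
        Polynomial.eval₂_pow, Polynomial.eval₂_sub, Polynomial.eval₂_X, Polynomial.eval₂_C,
        Polynomial.eval₂_finsetProd] at hev
      rw [Finset.prod_insert hρ, ← eval₂_div_pow_eq_sum (P * b) ρ (m ρ) (hρ' t),
        Polynomial.eval₂_mul, Polynomial.eval₂_mul, div_add_div _ _ (hH0 t) (hG0 t),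
        div_eq_div_iff (mul_ne_zero (hG0 t) (hH0 t)) (mul_ne_zero (hH0 t) (hG0 t))]
      linear_combination (-(P.eval₂ (algebraMap K ℂ) (x t) * (x t - algebraMap K ℂ ρ) ^ m ρ *
        ∏ σ ∈ s, (x t - algebraMap K ℂ σ) ^ m σ)) * hev
    have hpf : ∀ t, P.eval₂ (algebraMap K ℂ) (x t) /
        (∏ σ ∈ insert ρ s, (x t - algebraMap K ℂ σ) ^ m σ) * deriv x t =
        (P * a).eval₂ (algebraMap K ℂ) (x t) / (∏ σ ∈ s, (x t - algebraMap K ℂ σ) ^ m σ) *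
          deriv x t +
        ∑ i ∈ (taylor ρ (P * b)).support, algebraMap K ℂ ((taylor ρ (P * b)).coeff i) *
          ((x t - algebraMap K ℂ ρ) ^ ((i : ℤ) - m ρ) * deriv x t) := by
      intro t
      rw [hpf0 t, add_mul, Finset.sum_mul]
      simp_rw [mul_assoc]
    simp_rw [hpf]
    -- integrate term by term
    have hi1 : IntervalIntegrable (fun t => (P * a).eval₂ (algebraMap K ℂ) (x t) /
        (∏ σ ∈ s, (x t - algebraMap K ℂ σ) ^ m σ) * deriv x t) MeasureTheory.volume 0 1 := by
      refine (Continuous.mul (Continuous.div ?_ (continuous_prod_pow_sub hx.continuous s m) hH0)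
        hxd).intervalIntegrable 0 1
      have hc := ((P * a).map (algebraMap K ℂ)).continuous.comp hx.continuous
      simpa only [Function.comp_def, Polynomial.eval_map] using hc
    have hi2 : ∀ i ∈ (taylor ρ (P * b)).support, IntervalIntegrable (fun t =>
        algebraMap K ℂ ((taylor ρ (P * b)).coeff i) *
          ((x t - algebraMap K ℂ ρ) ^ ((i : ℤ) - m ρ) * deriv x t)) MeasureTheory.volume 0 1 :=
      fun i _ => (continuous_const.mul ((((hx.continuous.sub continuous_const).zpow₀ _)
        fun t => Or.inl (sub_ne_zero.2 (hρ' t))).mul hxd)).intervalIntegrable 0 1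
    have hi2' : IntervalIntegrable (fun t => ∑ i ∈ (taylor ρ (P * b)).support,
        algebraMap K ℂ ((taylor ρ (P * b)).coeff i) *
          ((x t - algebraMap K ℂ ρ) ^ ((i : ℤ) - m ρ) * deriv x t)) MeasureTheory.volume 0 1 := by
      have h := IntervalIntegrable.sum _ hi2
      rwa [Finset.sum_fn] at h
    rw [intervalIntegral.integral_add hi1 hi2', intervalIntegral.integral_finsetSum hi2,
      hc' x hx h01 hs']
    simp_rw [intervalIntegral.integral_const_mul, integral_zpow_sub_mul_deriv hx h01 _ hρ',
      mul_ite, mul_zero]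
    -- collect: the old residues on `s`, the new one at `ρ`
    have hupd : ∑ σ ∈ s, algebraMap K ℂ (Function.update c' ρ (∑ i ∈ (taylor ρ (P * b)).support,
        if (i : ℤ) - m ρ = -1 then (taylor ρ (P * b)).coeff i else 0) σ) *
          (wind (fun t => x t - algebraMap K ℂ σ) : ℂ) =
        ∑ σ ∈ s, algebraMap K ℂ (c' σ) * (wind (fun t => x t - algebraMap K ℂ σ) : ℂ) :=
      Finset.sum_congr rfl fun σ hσ => by rw [Function.update_of_ne (ne_of_mem_of_not_mem hσ hρ)]
    rw [Finset.sum_insert hρ, Function.update_self, hupd, add_mul, add_comm]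
    congr 1
    rw [map_sum, Finset.sum_mul, Finset.sum_mul]
    refine Finset.sum_congr rfl fun i _ => ?_
    split_ifs with h
    · ring
    · rw [map_zero, zero_mul, zero_mul]

end Rational

end ClosedPathPeriods


namespace ClosedPathPeriods

open Literature.Topology.PlaneTopology Literature.Analysis.Complex

/-! ### Graphs of rational functions `y q(x) = r(x)` over `ℚ` -/

section RatGraph

open IntermediateField


/-- **Clearing denominators**: for `A ∈ ℚ[x, y]` and `q, r ∈ ℚ[x]` there are `P ∈ ℚ[x]` and
`N ∈ ℕ` with `A(z, r(z)/q(z)) = P(z)/q(z)^N` whenever `q(z) ≠ 0`. [folklore] -/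
theorem exists_num_of_ratSubst (q r : ℚ[X]) (A : MvPolynomial (Fin 2) ℚ) :
    ∃ (P : ℚ[X]) (N : ℕ), ∀ z : ℂ, Polynomial.aeval z q ≠ 0 →
      MvPolynomial.aeval ![z, Polynomial.aeval z r / Polynomial.aeval z q] A =
        Polynomial.aeval z P / Polynomial.aeval z q ^ N := by
  induction A using MvPolynomial.induction_on with
  | C a =>
    refine ⟨Polynomial.C a, 0, fun z _ => ?_⟩
    simp only [MvPolynomial.aeval_C, Polynomial.aeval_C, pow_zero, div_one]
  | add p p' hp hp' =>
    obtain ⟨P, N, h⟩ := hp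
    obtain ⟨P', N', h'⟩ := hp'
    refine ⟨P * q ^ N' + P' * q ^ N, N + N', fun z hz => ?_⟩
    rw [map_add, h z hz, h' z hz, div_add_div _ _ (pow_ne_zero _ hz) (pow_ne_zero _ hz)]
    simp only [map_add, map_mul, map_pow]
    ring
  | mul_X p i hp =>
    obtain ⟨P, N, h⟩ := hp
    fin_cases i
    · refine ⟨P * Polynomial.X, N, fun z hz => ?_⟩
      rw [map_mul, h z hz]
      simp only [Fin.zero_eta, Fin.isValue, MvPolynomial.aeval_X, Matrix.cons_val_zero, map_mul,
        Polynomial.aeval_X]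
      ring
    · refine ⟨P * r, N + 1, fun z hz => ?_⟩
      rw [map_mul, h z hz]
      simp only [Fin.mk_one, Fin.isValue, MvPolynomial.aeval_X, Matrix.cons_val_one,
        Matrix.cons_val_zero, map_mul, pow_succ]
      rw [div_mul_div_comm]

/-- **Complete periods on the graph of a rational function are `K · 2πi`-valued, `K = ℚ̄`.**
For coprime `q, r ∈ ℚ[x]`, `q ≠ 0`, and `A, B ∈ ℚ[x, y]` there is a finite set `s ⊂ ℚ̄` (the
roots of `q`) and residues `c_ρ ∈ ℚ̄` such that for every closed `C¹` loop `γ = (x, y)` on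
`y q(x) = r(x)`: `x` avoids `s` and `∮_γ (A dx + B dy) = 2πi · Σ_{ρ ∈ s} c_ρ wind(x − ρ)`.
(The form pulls back to the rational form `(A(x, r/q) + B(x, r/q)(r/q)′) dx`, poles only at
the roots of `q`; `exists_residues_prod`.) [folklore] -/
theorem exists_residues_of_ratGraph (q r : ℚ[X]) (hqr : IsCoprime q r) (hq : q ≠ 0)
    (A B : MvPolynomial (Fin 2) ℚ) :
    ∃ (s : Finset (algebraicClosure ℚ ℂ)) (c : algebraicClosure ℚ ℂ → algebraicClosure ℚ ℂ),
      ∀ γ : ℝ → (Fin 2 → ℂ), ContDiff ℝ 1 γ → Function.Periodic γ 1 →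
      (∀ t, γ t 1 * Polynomial.aeval (γ t 0) q = Polynomial.aeval (γ t 0) r) →
      (∀ t, ∀ ρ ∈ s, γ t 0 ≠ (ρ : ℂ)) ∧
      (∫ t in (0:ℝ)..1, (aeval (γ t) A * deriv (fun s => γ s 0) t +
          aeval (γ t) B * deriv (fun s => γ s 1) t)) =
        (∑ ρ ∈ s, (c ρ : ℂ) * wind (fun t => γ t 0 - (ρ : ℂ))) * (2 * π * I) := by
  classical
  -- no common zero of `q` and `r`
  obtain ⟨u, v, huv⟩ := hqr
  have hq0 : ∀ z y : ℂ, y * Polynomial.aeval z q = Polynomial.aeval z r →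
      Polynomial.aeval z q ≠ 0 := by
    intro z y hy h0
    have h := congrArg (Polynomial.aeval z) huv
    rw [map_add, map_mul, map_mul, map_one, h0, mul_zero, zero_add, ← hy, h0, mul_zero,
      mul_zero] at h
    exact zero_ne_one h
  -- clear denominators
  obtain ⟨PA, NA, hA⟩ := exists_num_of_ratSubst q r A
  obtain ⟨PB, NB, hB⟩ := exists_num_of_ratSubst q r B
  -- the roots of `q` in `ℚ̄`, with multiplicities
  haveI : IsAlgClosed (algebraicClosure ℚ ℂ) := (algebraicClosure.isAlgClosure ℚ ℂ).isAlgClosed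
  set qK : (algebraicClosure ℚ ℂ)[X] := q.map (algebraMap ℚ (algebraicClosure ℚ ℂ)) with hqK
  have hqK0 : qK ≠ 0 := (Polynomial.map_ne_zero_iff (algebraMap ℚ (algebraicClosure ℚ ℂ)).injective).2 hq
  have hlead : qK.leadingCoeff ≠ 0 := Polynomial.leadingCoeff_ne_zero.2 hqK0
  set s : Finset (algebraicClosure ℚ ℂ) := qK.roots.toFinset with hs
  set m : (algebraicClosure ℚ ℂ) → ℕ := fun ρ => qK.roots.count ρ with hm
  -- `q(z) = lead · ∏ (z - ρ)^{m ρ}`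
  have hfac : ∀ z : ℂ, Polynomial.aeval z q =
      (qK.leadingCoeff : ℂ) * ∏ ρ ∈ s, (z - (ρ : ℂ)) ^ m ρ := by
    intro z
    have h := (IsAlgClosed.splits qK).eq_prod_roots
    have h2 : Polynomial.aeval z qK = Polynomial.aeval z q := by
      rw [hqK, Polynomial.aeval_map_algebraMap]
    rw [← h2]
    conv_lhs => rw [h]
    rw [map_mul, Polynomial.aeval_C, IntermediateField.algebraMap_apply, map_multiset_prod,
      Multiset.map_map, Finset.prod_multiset_map_count]
    congr 1
    refine Finset.prod_congr rfl fun ρ _ => ?_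
    simp only [Function.comp_apply, map_sub, Polynomial.aeval_X, Polynomial.aeval_C,
      IntermediateField.algebraMap_apply]
    rfl
  -- the total numerator: `(A + B (r/q)′) dx = Ptot/q^N dx`, `N = NA + NB + 2`
  set N : ℕ := NA + NB + 2 with hN
  set Ptot : ℚ[X] := PA * q ^ (NB + 2) +
    PB * (Polynomial.derivative r * q - r * Polynomial.derivative q) * q ^ NA with hPtot
  set PK : (algebraicClosure ℚ ℂ)[X] := Polynomial.C (qK.leadingCoeff ^ N)⁻¹ * Ptot.map (algebraMap ℚ (algebraicClosure ℚ ℂ)) with hPK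
  obtain ⟨c, hc⟩ := exists_residues_prod s (fun ρ => N * m ρ) PK
  refine ⟨s, c, fun γ hC hper hon => ?_⟩
  have hqx : ∀ t, Polynomial.aeval (γ t 0) q ≠ 0 := fun t => hq0 _ _ (hon t)
  -- the loop avoids the roots of `q`
  have havoid : ∀ t, ∀ ρ ∈ s, γ t 0 ≠ (ρ : ℂ) := by
    intro t ρ hρ heq
    apply hqx t
    rw [hfac, Finset.prod_eq_zero hρ, mul_zero]
    have hm1 : m ρ ≠ 0 := (Multiset.count_pos.2 (Multiset.mem_toFinset.1 hρ)).ne'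
    rw [heq, sub_self, zero_pow hm1]
  refine ⟨havoid, ?_⟩
  -- `y = r(x)/q(x)` and its derivative
  have hx1 : ContDiff ℝ 1 fun t => γ t 0 := contDiff_pi.1 hC 0
  have hxd : ∀ t, HasDerivAt (fun s => γ s 0) (deriv (fun s => γ s 0) t) t := fun t =>
    ((hx1.differentiable one_ne_zero) t).hasDerivAt
  have hy : ∀ t, γ t 1 = Polynomial.aeval (γ t 0) r / Polynomial.aeval (γ t 0) q := fun t =>
    (eq_div_iff (hqx t)).2 (hon t)
  have hyd : ∀ t, deriv (fun s => γ s 1) t =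
      (Polynomial.aeval (γ t 0) (Polynomial.derivative r) * Polynomial.aeval (γ t 0) q -
        Polynomial.aeval (γ t 0) r * Polynomial.aeval (γ t 0) (Polynomial.derivative q)) /
        Polynomial.aeval (γ t 0) q ^ 2 * deriv (fun s => γ s 0) t := by
    intro t
    have hfun : (fun s => γ s 1) = fun s =>
        Polynomial.aeval (γ s 0) r / Polynomial.aeval (γ s 0) q := funext hy
    rw [hfun]
    have hr := (r.hasDerivAt_aeval (γ t 0)).comp t (hxd t)
    have hq' := (q.hasDerivAt_aeval (γ t 0)).comp t (hxd t)
    have hd : HasDerivAt (fun s => Polynomial.aeval (γ s 0) r / Polynomial.aeval (γ s 0) q)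
        ((Polynomial.aeval (γ t 0) (Polynomial.derivative r) * deriv (fun s => γ s 0) t *
            Polynomial.aeval (γ t 0) q -
          Polynomial.aeval (γ t 0) r *
            (Polynomial.aeval (γ t 0) (Polynomial.derivative q) * deriv (fun s => γ s 0) t)) /
          Polynomial.aeval (γ t 0) q ^ 2) t := hr.div hq' (hqx t)
    rw [hd.deriv]
    ring
  -- the integrand is `PK(x)/∏(x - ρ)^{N m ρ} · x′`
  have hint : ∀ t, aeval (γ t) A * deriv (fun s => γ s 0) t +
      aeval (γ t) B * deriv (fun s => γ s 1) t =
      PK.eval₂ (algebraMap (algebraicClosure ℚ ℂ) ℂ) (γ t 0) / (∏ ρ ∈ s, (γ t 0 - algebraMap (algebraicClosure ℚ ℂ) ℂ ρ) ^ (N * m ρ)) *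
        deriv (fun s => γ s 0) t := by
    intro t
    have hγt : γ t = ![γ t 0, Polynomial.aeval (γ t 0) r / Polynomial.aeval (γ t 0) q] := by
      ext j
      fin_cases j
      · simp
      · simpa using hy t
    have hqz := hqx t
    have hprod : (∏ ρ ∈ s, (γ t 0 - algebraMap (algebraicClosure ℚ ℂ) ℂ ρ) ^ (N * m ρ)) =
        (∏ ρ ∈ s, (γ t 0 - (ρ : ℂ)) ^ m ρ) ^ N := by
      rw [← Finset.prod_pow]
      refine Finset.prod_congr rfl fun ρ _ => ?_
      rw [IntermediateField.algebraMap_apply, mul_comm, pow_mul]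
    have hPK' : PK.eval₂ (algebraMap (algebraicClosure ℚ ℂ) ℂ) (γ t 0) =
        ((qK.leadingCoeff : ℂ) ^ N)⁻¹ * Polynomial.aeval (γ t 0) Ptot := by
      rw [hPK, Polynomial.eval₂_mul, Polynomial.eval₂_C, ← Polynomial.aeval_def,
        Polynomial.aeval_map_algebraMap, map_inv₀, map_pow, IntermediateField.algebraMap_apply]
    have hlead' : ((qK.leadingCoeff : (algebraicClosure ℚ ℂ)) : ℂ) ≠ 0 := by exact_mod_cast hlead
    have hP0 : (∏ ρ ∈ s, (γ t 0 - (ρ : ℂ)) ^ m ρ) ≠ 0 :=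
      Finset.prod_ne_zero_iff.2 fun ρ hρ => pow_ne_zero _ (sub_ne_zero.2 (havoid t ρ hρ))
    have hAt : MvPolynomial.aeval (γ t) A =
        MvPolynomial.aeval ![γ t 0, Polynomial.aeval (γ t 0) r / Polynomial.aeval (γ t 0) q] A :=
      congrArg (fun w => MvPolynomial.aeval w A) hγt
    have hBt : MvPolynomial.aeval (γ t) B =
        MvPolynomial.aeval ![γ t 0, Polynomial.aeval (γ t 0) r / Polynomial.aeval (γ t 0) q] B :=
      congrArg (fun w => MvPolynomial.aeval w B) hγt
    rw [hyd t, hAt, hBt, hA _ hqz, hB _ hqz, hprod, hPK', hPtot]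
    simp only [map_add, map_mul, map_pow, map_sub]
    rw [hfac (γ t 0)]
    field_simp
    ring
  simp_rw [hint]
  have h01 : γ 0 0 = γ 1 0 := by
    have h := hper 0
    rw [zero_add] at h
    rw [h]
  have key := hc (fun t => γ t 0) hx1 h01 (fun t ρ hρ => by
    rw [IntermediateField.algebraMap_apply]; exact havoid t ρ hρ)
  simpa only [IntermediateField.algebraMap_apply] using key

end RatGraph

end ClosedPathPeriods

open Literature.Topology.PlaneTopology in
/-- **The rational-graph slice of the named fact is a theorem**:
`completePlaneCurvePeriods_zero_or_transcendental` holds for every curve `y q(x) = r(x)` with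
`q, r ∈ ℚ[x]` coprime (graphs of rational functions over `ℚ`: lines, parabolas, the hyperbola
`xy = 1`, `y (x² + 1) = 1`, …), unconditionally.  Along a closed loop on the curve `x` avoids
the (algebraic) roots of `q`, the form `A dx + B dy` pulls back to a rational form over `ℚ` in
`x`, and by the residue theorem along loops (`ClosedPathPeriods.exists_residues_prod`, partial
fractions) the complete period is `2πi · Σ_ρ c_ρ W_ρ` with residues `c_ρ ∈ ℚ̄` and integers
`W_ρ = Σᵢ nᵢ wind(xᵢ − ρ)`; an algebraic value must therefore vanish (Lindemann,
`transcendental_pi_holds`).  This is the genus-`0` case "`C° = ℙ¹ ∖ {poles}`" of Huber–Wüstholz,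
Thm. 13.9 / Cor. 13.13 (Remark 13.10: transcendence of `π`; cf. Lemma 12.4 for `𝔸¹`).
[cite: HuberWustholz2022, Cor. 13.13 (p. 126) and Remark 13.10 (p. 125); Lindemann1882] -/
theorem completePlaneCurvePeriods_zero_or_transcendental_of_ratGraph (q r : ℚ[X])
    (hqr : IsCoprime q r) (A B : MvPolynomial (Fin 2) ℚ) (k : ℕ) (n : Fin k → ℤ)
    (γ : Fin k → ℝ → (Fin 2 → ℂ))
    (hγ : ∀ i, ContDiff ℝ 1 (γ i) ∧ Function.Periodic (γ i) 1 ∧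
      ∀ t, aeval (γ i t) (X 1 * Polynomial.aeval (X 0) q - Polynomial.aeval (X 0) r :
          MvPolynomial (Fin 2) ℚ) = 0 ∧
        ∃ j, aeval (γ i t) (pderiv j (X 1 * Polynomial.aeval (X 0) q - Polynomial.aeval (X 0) r :
          MvPolynomial (Fin 2) ℚ)) ≠ 0)
    (halg : IsAlgebraic ℚ (∑ i, (n i : ℂ) * ∫ t in (0:ℝ)..1,
      (aeval (γ i t) A * deriv (fun s => γ i s 0) t +
        aeval (γ i t) B * deriv (fun s => γ i s 1) t))) :
    (∑ i, (n i : ℂ) * ∫ t in (0:ℝ)..1,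
      (aeval (γ i t) A * deriv (fun s => γ i s 0) t +
        aeval (γ i t) B * deriv (fun s => γ i s 1) t)) = 0 := by
  -- the curve equation `y q(x) = r(x)` along the loops
  have hon : ∀ i t, γ i t 1 * Polynomial.aeval (γ i t 0) q = Polynomial.aeval (γ i t 0) r := by
    intro i t
    have h := ((hγ i).2.2 t).1
    rw [map_sub, map_mul, aeval_X, ← Polynomial.aeval_algHom_apply, ← Polynomial.aeval_algHom_apply,
      aeval_X, sub_eq_zero] at h
    exact h
  by_cases hq : q = 0
  · -- `q = 0`: then `r` is a non-zero constant and the curve is empty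
    subst hq
    refine Finset.sum_eq_zero fun i _ => ?_
    exfalso
    have hu : IsUnit r := isCoprime_zero_left.1 hqr
    obtain ⟨c, hc0, hcr⟩ := Polynomial.isUnit_iff.1 hu
    have h := hon i 0
    rw [map_zero, mul_zero, ← hcr, Polynomial.aeval_C, eq_comm, map_eq_zero_iff _
      (algebraMap ℚ ℂ).injective] at h
    exact hc0.ne_zero h
  obtain ⟨s, c, hsc⟩ := ClosedPathPeriods.exists_residues_of_ratGraph q r hqr hq A B
  have hI : ∀ i, (∫ t in (0:ℝ)..1, (aeval (γ i t) A * deriv (fun s => γ i s 0) t +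
      aeval (γ i t) B * deriv (fun s => γ i s 1) t)) =
      (∑ ρ ∈ s, (c ρ : ℂ) * wind (fun t => γ i t 0 - (ρ : ℂ))) * (2 * π * I) := fun i =>
    (hsc (γ i) (hγ i).1 (hγ i).2.1 (hon i)).2
  have hS : (∑ i, (n i : ℂ) * ∫ t in (0:ℝ)..1, (aeval (γ i t) A * deriv (fun s => γ i s 0) t +
      aeval (γ i t) B * deriv (fun s => γ i s 1) t)) =
      ((∑ ρ ∈ s, c ρ * ((∑ i, n i * wind (fun t => γ i t 0 - (ρ : ℂ)) : ℤ) :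
        algebraicClosure ℚ ℂ) : algebraicClosure ℚ ℂ) : ℂ) * (2 * π * I) := by
    simp_rw [hI]
    push_cast
    simp_rw [Finset.mul_sum, Finset.sum_mul, Finset.mul_sum]
    rw [Finset.sum_comm]
    refine Finset.sum_congr rfl fun ρ _ => Finset.sum_congr rfl fun i _ => ?_
    ring
  rw [hS] at halg ⊢
  rw [ClosedPathPeriods.eq_zero_of_isAlgebraic_mul_two_pi_I (mem_algebraicClosure_iff.1
    (SetLike.coe_mem _)) halg, zero_mul]


/-! ### Swapping the coordinates -/

/-- **The named fact is symmetric in `x ↔ y`**: if its conclusion holds for the curve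
`p(y, x) = 0` (all forms, loops, multiplicities), then it holds for `p(x, y) = 0` — swap the
coordinates of the loops and the roles of `A` and `B`. [folklore] -/
theorem completePlaneCurvePeriods_of_swap (p : MvPolynomial (Fin 2) ℚ)
    (h : ∀ (A B : MvPolynomial (Fin 2) ℚ) (k : ℕ) (n : Fin k → ℤ) (γ : Fin k → ℝ → (Fin 2 → ℂ)),
      (∀ i, ContDiff ℝ 1 (γ i) ∧ Function.Periodic (γ i) 1 ∧
        ∀ t, aeval (γ i t) (rename (Equiv.swap (0 : Fin 2) 1) p) = 0 ∧
          ∃ j, aeval (γ i t) (pderiv j (rename (Equiv.swap (0 : Fin 2) 1) p)) ≠ 0) →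
      IsAlgebraic ℚ (∑ i, (n i : ℂ) * ∫ t in (0:ℝ)..1,
        (aeval (γ i t) A * deriv (fun s => γ i s 0) t +
          aeval (γ i t) B * deriv (fun s => γ i s 1) t)) →
      (∑ i, (n i : ℂ) * ∫ t in (0:ℝ)..1,
        (aeval (γ i t) A * deriv (fun s => γ i s 0) t +
          aeval (γ i t) B * deriv (fun s => γ i s 1) t)) = 0)
    (A B : MvPolynomial (Fin 2) ℚ) (k : ℕ) (n : Fin k → ℤ) (γ : Fin k → ℝ → (Fin 2 → ℂ))
    (hγ : ∀ i, ContDiff ℝ 1 (γ i) ∧ Function.Periodic (γ i) 1 ∧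
      ∀ t, aeval (γ i t) p = 0 ∧ ∃ j, aeval (γ i t) (pderiv j p) ≠ 0)
    (halg : IsAlgebraic ℚ (∑ i, (n i : ℂ) * ∫ t in (0:ℝ)..1,
      (aeval (γ i t) A * deriv (fun s => γ i s 0) t +
        aeval (γ i t) B * deriv (fun s => γ i s 1) t))) :
    (∑ i, (n i : ℂ) * ∫ t in (0:ℝ)..1,
      (aeval (γ i t) A * deriv (fun s => γ i s 0) t +
        aeval (γ i t) B * deriv (fun s => γ i s 1) t)) = 0 := by
  set σ : Equiv.Perm (Fin 2) := Equiv.swap (0 : Fin 2) 1 with hσ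
  -- the swapped loops
  set γ' : Fin k → ℝ → (Fin 2 → ℂ) := fun i t => γ i t ∘ σ with hγ'
  have hswap : ∀ (i t) (q : MvPolynomial (Fin 2) ℚ), aeval (γ' i t) (rename σ q) = aeval (γ i t) q := by
    intro i t q
    rw [aeval_rename]
    have hfun : γ' i t ∘ σ = γ i t := by
      funext j
      simp [hγ', Function.comp_def, hσ, Equiv.swap_apply_self]
    rw [hfun]
  have h0 : ∀ i t, γ' i t 0 = γ i t 1 := fun i t => by simp [hγ', hσ]
  have h1 : ∀ i t, γ' i t 1 = γ i t 0 := fun i t => by simp [hγ', hσ]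
  -- the same complete period, written on the swapped data
  have hsum : (∑ i, (n i : ℂ) * ∫ t in (0:ℝ)..1,
      (aeval (γ i t) A * deriv (fun s => γ i s 0) t +
        aeval (γ i t) B * deriv (fun s => γ i s 1) t)) =
      ∑ i, (n i : ℂ) * ∫ t in (0:ℝ)..1,
        (aeval (γ' i t) (rename σ B) * deriv (fun s => γ' i s 0) t +
          aeval (γ' i t) (rename σ A) * deriv (fun s => γ' i s 1) t) := by
    refine Finset.sum_congr rfl fun i _ => ?_
    congr 1
    refine intervalIntegral.integral_congr fun t _ => ?_
    simp only [hswap, h0, h1]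
    ring
  rw [hsum] at halg ⊢
  refine h (rename σ B) (rename σ A) k n γ' (fun i => ⟨?_, ?_, fun t => ⟨?_, ?_⟩⟩) halg
  · exact contDiff_pi.2 fun j => contDiff_pi.1 (hγ i).1 (σ j)
  · intro t
    simp only [hγ']
    rw [(hγ i).2.1 t]
  · rw [hswap]
    exact ((hγ i).2.2 t).1
  · obtain ⟨j, hj⟩ := ((hγ i).2.2 t).2
    refine ⟨σ j, ?_⟩
    have hpd : pderiv (σ j) (rename σ p) = rename σ (pderiv j p) := by
      rw [pderiv_rename σ.injective]
    rw [hpd, hswap]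
    exact hj

/-- **The rational-graph slice, `x` as a function of `y`**: the named fact holds for every
curve `x q(y) = r(y)` with `q, r ∈ ℚ[y]` coprime (by `completePlaneCurvePeriods_of_swap`).
[cite: HuberWustholz2022, Cor. 13.13 (p. 126) and Remark 13.10 (p. 125); Lindemann1882] -/
theorem completePlaneCurvePeriods_zero_or_transcendental_of_ratGraph' (q r : ℚ[X])
    (hqr : IsCoprime q r) (A B : MvPolynomial (Fin 2) ℚ) (k : ℕ) (n : Fin k → ℤ)
    (γ : Fin k → ℝ → (Fin 2 → ℂ))
    (hγ : ∀ i, ContDiff ℝ 1 (γ i) ∧ Function.Periodic (γ i) 1 ∧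
      ∀ t, aeval (γ i t) (X 0 * Polynomial.aeval (X 1) q - Polynomial.aeval (X 1) r :
          MvPolynomial (Fin 2) ℚ) = 0 ∧
        ∃ j, aeval (γ i t) (pderiv j (X 0 * Polynomial.aeval (X 1) q - Polynomial.aeval (X 1) r :
          MvPolynomial (Fin 2) ℚ)) ≠ 0)
    (halg : IsAlgebraic ℚ (∑ i, (n i : ℂ) * ∫ t in (0:ℝ)..1,
      (aeval (γ i t) A * deriv (fun s => γ i s 0) t +
        aeval (γ i t) B * deriv (fun s => γ i s 1) t))) :
    (∑ i, (n i : ℂ) * ∫ t in (0:ℝ)..1,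
      (aeval (γ i t) A * deriv (fun s => γ i s 0) t +
        aeval (γ i t) B * deriv (fun s => γ i s 1) t)) = 0 := by
  refine completePlaneCurvePeriods_of_swap _ (fun A' B' k' n' γ' hγ' halg' => ?_) A B k n γ hγ halg
  have hren : rename (Equiv.swap (0 : Fin 2) 1)
      (X 0 * Polynomial.aeval (X 1) q - Polynomial.aeval (X 1) r : MvPolynomial (Fin 2) ℚ) =
      X 1 * Polynomial.aeval (X 0) q - Polynomial.aeval (X 0) r := by
    rw [map_sub, map_mul, rename_X, ← Polynomial.aeval_algHom_apply,
      ← Polynomial.aeval_algHom_apply, rename_X]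
    simp [Equiv.swap_apply_left, Equiv.swap_apply_right]
  rw [hren] at hγ'
  exact completePlaneCurvePeriods_zero_or_transcendental_of_ratGraph q r hqr A' B' k' n' γ' hγ' halg'


namespace ClosedPathPeriods

open Literature.Topology.PlaneTopology Literature.Analysis.Complex

/-! ### The residue theorem for an arbitrary rational form over an algebraically closed `K ⊆ ℂ` -/

section RationalGeneral

open Polynomial

variable {K : Type*} [Field K] [Algebra K ℂ] [DecidableEq K]

/-- Over an algebraically closed field `K ⊆ ℂ` a polynomial factors pointwise over its roots:
`Q(z) = lead(Q) · ∏_{ρ} (z − ρ)^{mult ρ}`. [folklore] -/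
theorem aeval_eq_leadingCoeff_mul_prod_roots [IsAlgClosed K] (Q : K[X]) (z : ℂ) :
    Polynomial.aeval z Q = algebraMap K ℂ Q.leadingCoeff *
      ∏ ρ ∈ Q.roots.toFinset, (z - algebraMap K ℂ ρ) ^ Q.roots.count ρ := by
  conv_lhs => rw [(IsAlgClosed.splits Q).eq_prod_roots]
  rw [map_mul, Polynomial.aeval_C, map_multiset_prod, Multiset.map_map,
    Finset.prod_multiset_map_count]
  congr 1
  refine Finset.prod_congr rfl fun ρ _ => ?_
  simp only [Function.comp_apply, map_sub, Polynomial.aeval_X, Polynomial.aeval_C]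

/-- **The residue theorem for a rational `1`-form `P/Q dx` along a closed `C¹` loop**, `K ⊆ ℂ`
algebraically closed (e.g. `K = ℚ̄ = algebraicClosure ℚ ℂ`), `Q ≠ 0`: there are residues
`c_ρ ∈ K` at the roots `ρ` of `Q` such that for every `C¹` loop `x` with `x 0 = x 1` on which
`Q` does not vanish

  `∮ P(x)/Q(x) dx = 2πi · Σ_{ρ : Q(ρ) = 0} c_ρ · wind(x − ρ)`;

in particular the integral lies in `K · 2πi` (for `K = ℚ̄`: zero or transcendental, by
Lindemann).  From `exists_residues_prod` and the factorisation of `Q` over its roots.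
[folklore] -/
theorem exists_residues [IsAlgClosed K] (P Q : K[X]) (hQ : Q ≠ 0) :
    ∃ c : K → K, ∀ x : ℝ → ℂ, ContDiff ℝ 1 x → x 0 = x 1 →
      (∀ t, Polynomial.aeval (x t) Q ≠ 0) →
      (∀ t, ∀ ρ ∈ Q.roots.toFinset, x t ≠ algebraMap K ℂ ρ) ∧
      (∫ t in (0:ℝ)..1, Polynomial.aeval (x t) P / Polynomial.aeval (x t) Q * deriv x t) =
        (∑ ρ ∈ Q.roots.toFinset, algebraMap K ℂ (c ρ) *
          wind (fun t => x t - algebraMap K ℂ ρ)) * (2 * π * I) := by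
  have hlead : Q.leadingCoeff ≠ 0 := Polynomial.leadingCoeff_ne_zero.2 hQ
  obtain ⟨c, hc⟩ := exists_residues_prod Q.roots.toFinset (fun ρ => Q.roots.count ρ)
    (Polynomial.C Q.leadingCoeff⁻¹ * P)
  refine ⟨c, fun x hx h01 hQx => ?_⟩
  have havoid : ∀ t, ∀ ρ ∈ Q.roots.toFinset, x t ≠ algebraMap K ℂ ρ := by
    intro t ρ hρ heq
    apply hQx t
    rw [aeval_eq_leadingCoeff_mul_prod_roots, Finset.prod_eq_zero hρ, mul_zero]
    have hm1 : Q.roots.count ρ ≠ 0 := (Multiset.count_pos.2 (Multiset.mem_toFinset.1 hρ)).ne'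
    rw [heq, sub_self, zero_pow hm1]
  refine ⟨havoid, ?_⟩
  rw [← hc x hx h01 havoid]
  refine intervalIntegral.integral_congr fun t _ => ?_
  have hl : algebraMap K ℂ Q.leadingCoeff ≠ 0 := by
    rwa [Ne, map_eq_zero_iff _ (algebraMap K ℂ).injective]
  have hP0 : (∏ ρ ∈ Q.roots.toFinset, (x t - algebraMap K ℂ ρ) ^ Q.roots.count ρ) ≠ 0 :=
    Finset.prod_ne_zero_iff.2 fun ρ hρ => pow_ne_zero _ (sub_ne_zero.2 (havoid t ρ hρ))
  simp only [aeval_eq_leadingCoeff_mul_prod_roots Q, ← Polynomial.aeval_def, map_mul,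
    Polynomial.aeval_C, map_inv₀]
  field_simp

end RationalGeneral

end ClosedPathPeriods


end Literature.NumberTheory.Transcendental

end
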